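import Literature.AlgebraicGeometry.Resolution.FormalInverseFunction
import Literature.RingTheory.MvPowerSeries.MaximalIdealPow
import HarnessLib

/-!
# `𝔪`-adic limits of substitutions of `K⟦x₁,…,xₙ⟧` (Boubakri–Greuel–Markwig, Lemma 2.2)

`Literature/RingTheory/MvPowerSeries/AdicLimit.lean`, grouping namespace
`Literature.RingTheory.MvPowerSeries.AdicLimit`. Everything here is PROVED (theorems only).

Source: Y. Boubakri, G.-M. Greuel, T. Markwig, *Invariants of hypersurface singularities in
positive characteristic*, Rev. Mat. Complut. 25 (2012), Lemma 2.2 and its proof (arXiv:1005.4503,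
p. 7): the coordinate changes `φ_p` of the finite-determinacy induction converge `𝔪`-adically, and
so do their values `φ_p(f₀)`. We isolate the four generic facts about `R = K⟦x₁,…,xₙ⟧`
(`K` a field, `𝔪` the maximal ideal) that this argument consists of:

* `exists_limit` : an `𝔪`-adically Cauchy sequence `w` with `w (q+1) - w q ∈ 𝔪 ^ (c+q)` has a
  limit `L` with `L - w q ∈ 𝔪 ^ (c+q)` for every `q` (coefficientwise stabilisation);
* `subst_sub_subst_mem_maximalIdeal_pow` : substitution is `𝔪`-adically continuous in the
  substituted family: if `a i ≡ a' i (mod 𝔪 ^ r)` (zero constant terms) then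
  `F(a) ≡ F(a') (mod 𝔪 ^ r)` for every `F`;
* `subst_X_add_sub_self_mem_maximalIdeal_pow` : `F(x + b) ≡ F (mod 𝔪 ^ r)` when all `b i ∈ 𝔪 ^ r`,
  `r ≥ 1`;
* `exists_algEquiv_of_sub_X_mem_sq` : a substitution `x i ↦ A i` with `A i ≡ x i (mod 𝔪 ²)` is a
  `K`-algebra AUTOmorphism of `R` (formal inverse function theorem with identity linear part,
  via `FormalCoordChange.exists_comp_inverse`).

Not covered here: the unit factor `u_p → u` of the contact case of Lemma 2.2 (it is the case
`F := ` the unit, handled by the consumer with `exists_limit` directly), and any topological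
statement (no `𝔪`-adic topology is put on `R`; all limits are expressed by congruences).
-/

noncomputable section

open MvPowerSeries IsLocalRing
open Literature.RingTheory.MvPowerSeries.Jets
open Literature.AlgebraicGeometry.Resolution.FormalCoordChange

namespace Literature.RingTheory.MvPowerSeries.AdicLimit

variable {n : ℕ} {K : Type*} [Field K]

/-! ### 1. Limits of `𝔪`-adically Cauchy sequences -/

/-- Coefficients of low degree of an `𝔪`-adically Cauchy sequence stabilise: if
`w (q+1) - w q ∈ 𝔪 ^ (c+q)` for all `q`, then for `q ≤ q'` and `|e| < c + q` the `e`-th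
coefficients of `w q` and `w q'` agree. [folklore] -/
theorem coeff_eq_coeff_of_le (w : ℕ → MvPowerSeries (Fin n) K) (c : ℕ)
    (hw : ∀ q, w (q + 1) - w q ∈ maximalIdeal (MvPowerSeries (Fin n) K) ^ (c + q))
    {e : Fin n →₀ ℕ} {q q' : ℕ} (hqq : q ≤ q') (he : e.degree < c + q) :
    coeff e (w q') = coeff e (w q) := by
  induction hqq with
  | refl => rfl
  | @step m hle ih =>
    have h0 : coeff e (w (m + 1) - w m) = 0 :=
      coeff_eq_zero_of_mem_maximalIdeal_pow (hw m) (by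
        have : q ≤ m := hle
        omega)
    rw [map_sub, sub_eq_zero] at h0
    rw [h0, ih]

/-- **`𝔪`-adic completeness of `K⟦x⟧`, Cauchy-sequence form.** A sequence `w` with
`w (q+1) - w q ∈ 𝔪 ^ (c+q)` converges: there is `L` with `L - w q ∈ 𝔪 ^ (c+q)` for every `q`
(the limit is read off coefficientwise, the `e`-th coefficient from `w (|e| + 1)`).
This is the convergence step ("the `φ_p(x_i)` converge to a power series `x_i + b_i`") of the
proof of Boubakri–Greuel–Markwig 2012, Lemma 2.2. [cite: BoubakriGreuelMarkwig2010, Lemma 2.2] -/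
theorem exists_limit (w : ℕ → MvPowerSeries (Fin n) K) (c : ℕ)
    (hw : ∀ q, w (q + 1) - w q ∈ maximalIdeal (MvPowerSeries (Fin n) K) ^ (c + q)) :
    ∃ L : MvPowerSeries (Fin n) K, ∀ q, L - w q ∈ maximalIdeal (MvPowerSeries (Fin n) K) ^ (c + q) := by
  refine ⟨(show MvPowerSeries (Fin n) K from fun e => coeff e (w (e.degree + 1))), fun q => ?_⟩
  refine mem_maximalIdeal_pow_of_coeff_eq_zero fun e he => ?_
  rw [map_sub, sub_eq_zero, coeff_apply]
  -- both sides agree with the coefficient at the index `max q (|e| + 1)`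
  have h1 : coeff e (w (max q (e.degree + 1))) = coeff e (w (e.degree + 1)) :=
    coeff_eq_coeff_of_le w c hw (le_max_right _ _) (by omega)
  have h2 : coeff e (w (max q (e.degree + 1))) = coeff e (w q) :=
    coeff_eq_coeff_of_le w c hw (le_max_left _ _) he
  rw [← h1, h2]

/-! ### 2. Substitution is `𝔪`-adically continuous in the substituted family -/

/-- If two substitution families with zero constant terms agree modulo `𝔪 ^ r` componentwise,
then the substituted series agree modulo `𝔪 ^ r`: `F(a) - F(a') ∈ 𝔪 ^ r`. This is the step
"`φ(f₀) - φ_p(f₀) ∈ 𝔪 ^ N` as soon as `φ(x_i) - φ_p(x_i) ∈ 𝔪 ^ N` for all `i`" of the proof of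
Boubakri–Greuel–Markwig 2012, Lemma 2.2. [cite: BoubakriGreuelMarkwig2010, Lemma 2.2] -/
theorem subst_sub_subst_mem_maximalIdeal_pow {a a' : Fin n → MvPowerSeries (Fin n) K}
    (ha : ∀ i, MvPowerSeries.constantCoeff (a i) = 0) (ha' : ∀ i, MvPowerSeries.constantCoeff (a' i) = 0)
    {r : ℕ} (h : ∀ i, a i - a' i ∈ maximalIdeal (MvPowerSeries (Fin n) K) ^ r) (F : MvPowerSeries (Fin n) K) :
    MvPowerSeries.subst a F - MvPowerSeries.subst a' F ∈ maximalIdeal (MvPowerSeries (Fin n) K) ^ r := by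
  cases r with
  | zero => rw [pow_zero, Ideal.one_eq_top]; exact Submodule.mem_top
  | succ r =>
    have hagree : ∀ i, AgreeUpTo r (a i) (a' i) := fun i =>
      agreeUpTo_iff_order.2 (le_order_of_mem_maximalIdeal_pow (h i))
    exact le_order_iff_mem_maximalIdeal_pow.1
      (agreeUpTo_iff_order.1 (AgreeUpTo.subst_congr hagree ha ha' F))

/-- `F(x + b) - F ∈ 𝔪 ^ r` whenever all `b i ∈ 𝔪 ^ r` and `r ≥ 1`. [folklore] -/
theorem subst_X_add_sub_self_mem_maximalIdeal_pow {b : Fin n → MvPowerSeries (Fin n) K} {r : ℕ} (hr : 1 ≤ r)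
    (hb : ∀ i, b i ∈ maximalIdeal (MvPowerSeries (Fin n) K) ^ r) (F : MvPowerSeries (Fin n) K) :
    MvPowerSeries.subst (fun i => MvPowerSeries.X i + b i) F - F ∈ maximalIdeal (MvPowerSeries (Fin n) K) ^ r := by
  have hb0 : ∀ i, constantCoeff (b i) = 0 := fun i =>
    mem_maximalIdeal_iff_constantCoeff_eq_zero.1 (Ideal.pow_le_self (by omega) (hb i))
  have hF : MvPowerSeries.subst (MvPowerSeries.X : Fin n → MvPowerSeries (Fin n) K) F = F := by
    rw [subst_self]; rfl
  have key := subst_sub_subst_mem_maximalIdeal_pow (a := fun i => MvPowerSeries.X i + b i)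
    (a' := MvPowerSeries.X) (r := r) (fun i => by rw [map_add, constantCoeff_X, hb0 i, add_zero])
    (fun i => constantCoeff_X i) (fun i => by simpa using hb i) F
  rwa [hF] at key

/-! ### 3. Substitutions tangent to the identity are automorphisms -/

/-- A substitution family `A` with `A i ≡ x i (mod 𝔪 ²)` has zero constant terms. [folklore] -/
theorem constantCoeff_eq_zero_of_sub_X_mem_sq {A : Fin n → MvPowerSeries (Fin n) K}
    (hA : ∀ i, A i - MvPowerSeries.X i ∈ maximalIdeal (MvPowerSeries (Fin n) K) ^ 2) (i : Fin n) :
    constantCoeff (A i) = 0 := by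
  have h0 : coeff (0 : Fin n →₀ ℕ) (A i - X i) = 0 :=
    coeff_eq_zero_of_mem_maximalIdeal_pow (hA i) (by simp)
  rwa [map_sub, coeff_zero_X, sub_zero, coeff_zero_eq_constantCoeff_apply] at h0

/-- A substitution family `A` with `A i ≡ x i (mod 𝔪 ²)` has the identity as linear part.
[folklore] -/
theorem linMat_eq_one_of_sub_X_mem_sq {A : Fin n → MvPowerSeries (Fin n) K}
    (hA : ∀ i, A i - MvPowerSeries.X i ∈ maximalIdeal (MvPowerSeries (Fin n) K) ^ 2) :
    linMat A = 1 := by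
  classical
  ext i j
  have h1 : coeff (Finsupp.single j 1) (A i - X i) = 0 :=
    coeff_eq_zero_of_mem_maximalIdeal_pow (hA i) (by simp)
  rw [map_sub, sub_eq_zero, coeff_index_single_X] at h1
  rw [linMat, Matrix.of_apply, h1, Matrix.one_apply]
  simp only [eq_comm]

/-- **Substitutions tangent to the identity modulo `𝔪 ²` are automorphisms.** If
`A i - x i ∈ 𝔪 ²` for all `i`, then `F ↦ F(A)` is a `K`-algebra automorphism of `K⟦x₁,…,xₙ⟧`
(its inverse is the substitution of the compositional inverse family given by the formal inverse
function theorem `FormalCoordChange.exists_comp_inverse`, the linear part of `A` being the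
identity matrix). This is the fact "`φ(x_i) = x_i + b_i` with `b_i ∈ 𝔪 ^ (M+1)` defines a
coordinate change `φ`" of the proof of Boubakri–Greuel–Markwig 2012, Lemma 2.2.
[cite: BoubakriGreuelMarkwig2010, Lemma 2.2] -/
theorem exists_algEquiv_of_sub_X_mem_sq {A : Fin n → MvPowerSeries (Fin n) K}
    (hA : ∀ i, A i - MvPowerSeries.X i ∈ maximalIdeal (MvPowerSeries (Fin n) K) ^ 2) :
    ∃ Φ : MvPowerSeries (Fin n) K ≃ₐ[K] MvPowerSeries (Fin n) K, ∀ F, Φ F = MvPowerSeries.subst A F := by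
  have hA0 : ∀ i, constantCoeff (A i) = 0 := constantCoeff_eq_zero_of_sub_X_mem_sq hA
  have hdet : IsUnit (linMat A).det := by
    rw [linMat_eq_one_of_sub_X_mem_sq hA, Matrix.det_one]
    exact isUnit_one
  obtain ⟨ψ, hψ0, hψA, hAψ⟩ := exists_comp_inverse hA0 hdet
  have hAs : HasSubst A := hasSubst_of_constantCoeff_zero hA0
  have hψs : HasSubst ψ := hasSubst_of_constantCoeff_zero hψ0
  -- the two composites are the identity
  have h1 : ∀ F : MvPowerSeries (Fin n) K, MvPowerSeries.subst A (MvPowerSeries.subst ψ F) = F := by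
    intro F
    rw [subst_comp_subst_apply hψs hAs]
    have : (fun s => MvPowerSeries.subst A (ψ s)) = (MvPowerSeries.X : Fin n → MvPowerSeries (Fin n) K) :=
      funext hAψ
    rw [this, subst_self, id]
  have h2 : ∀ F : MvPowerSeries (Fin n) K, MvPowerSeries.subst ψ (MvPowerSeries.subst A F) = F := by
    intro F
    rw [subst_comp_subst_apply hAs hψs]
    have : (fun s => MvPowerSeries.subst ψ (A s)) = (MvPowerSeries.X : Fin n → MvPowerSeries (Fin n) K) :=
      funext hψA
    rw [this, subst_self, id]
  refine ⟨AlgEquiv.ofAlgHom (substAlgHom hAs) (substAlgHom hψs) ?_ ?_, fun F => ?_⟩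
  · ext1 F
    rw [AlgHom.comp_apply, substAlgHom_apply, substAlgHom_apply, AlgHom.id_apply, h1]
  · ext1 F
    rw [AlgHom.comp_apply, substAlgHom_apply, substAlgHom_apply, AlgHom.id_apply, h2]
  · rw [AlgEquiv.ofAlgHom_apply, substAlgHom_apply]

end Literature.RingTheory.MvPowerSeries.AdicLimit

end
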